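import Mathlib
import Summits.NavierStokesRegularity.NavierStokesRegularity.Theorems.TaoLadderRungTwoBreakBlowupRigidityOneFrontSharpness
import HarnessLib

/-!
# THE HEAD OF THE FRONT IS BRIGHT: while shell `n` is the newest lit shell (`s_n ≤ t ≤ s_{n+1}`), it reaches normalised
  amplitude `u_n > L` — for all but `4L²` shells — along every exact cascade blow-up; support for `stub_eternalFromBlowup` of
  K2(1) `TaoLadderRungTwoBreak.BlowupRigidityOne` (stmt-NavierStokesRegularity-20206)

MODEL lattice ODEs only (Tao 2016 §4 (4.3), Lemma 4.1 (4.5)–(4.10), (4.12)); nothing here is a statement about the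
Navier–Stokes equations; NO item is closed (`--supports stmt-NavierStokesRegularity-20206`). General `m`; DEF-FREE.

`OrderedIgnition`/`UpperClock` bounded the hop times by the GLOBAL peaks `sup_{[0,T)} u_n`. The integral in
`u_{n+1}(s) ≤ T⁻¹∫₀ˢ u_n²` only sees `u_n` up to the lighting time of shell `n+1`, so the same chain runs with the HEAD PEAKS
`H_n := sup {u_n(t) : s_n ≤ t ≤ s_{n+1}}` — the amplitude of shell `n` during its tenure as the leading lit shell (shell `n+1`
still unlit, nothing above it by `tailEnergy_small_of_unlit`):
* `firstLit_mem` — the first-lit time is attained: `u_n(s_n) ≥ 1/2` (closedness by continuity);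
* `hopTime_head` — `(s_{n+1} - s_n) · H_n² > T/4` for any bound `H_n ≥ u_n` on `[s_n, s_{n+1}]`;
* `exists_firstLitTimes_head` — the first-lit chain with the head-peak hop inequality and
  **`Σ_{n<N} H_n⁻² < 4`**, **fewer than `4L²` shells with head peak `≤ L`**: the critical amplitude is carried AT THE HEAD of
  the front, when it is needed to light the next shell — not at some later time in the wake;
* `headPeaks_of_noGlobalCascade` — the package along the maximal exact flow of every robust blow-up;
* `unlit_early` / `lit_late` — high shells are unlit before any `T' < T` at any threshold: the first-lit times tend to `T`.

HONEST LABEL. Unconditional a-priori dynamics at the critical scaling; the stub's (S₁) floor / lower clock / periodicity are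
untouched. No stub, crux or summit is proved; rung 0.
-/

noncomputable section

-- the summit and its single sub-problem share the name (CONVENTIONS §1)
set_option linter.dupNamespace false

open Set Filter Topology MeasureTheory intervalIntegral

namespace Summit.NavierStokesRegularity.NavierStokesRegularity.Theorems

namespace BlowupRigidityOne

open Literature.Analysis.FluidPDE Literature.Analysis.FluidPDE.TaoCascade

variable {m : ℕ}

/-- **The first-lit time is attained.** For a flow continuous on `[0,T)` (from `hder`) and the lit set
`S = {s ∈ [0,T) : u_n(s) ≥ 1/2}` nonempty: `u_n(inf S) ≥ 1/2`. [cite: Tao2016AveragedNS, §4 Lemma 4.1 (4.8) (continuity of the flow)] -/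
theorem firstLit_mem {ε₀ T : ℝ} {α : Fin m → Fin m → Fin m → ℤ × ℤ × ℤ → ℝ} {X : Fin m → ℤ → ℝ → ℝ}
    (hder : ∀ i k, ∀ t ∈ Ico 0 T, HasDerivWithinAt (X i k) (quadTerm ε₀ α X i k t) (Ici 0) t)
    (n : ℕ)
    (hne : {s : ℝ | 0 ≤ s ∧ s < T ∧ 1 / 2 ≤ fluxConst α * T * bigLam ε₀ ^ (n + 1) * ‖shellVec X (n : ℤ) s‖}.Nonempty) :
    1 / 2 ≤ fluxConst α * T * bigLam ε₀ ^ (n + 1) * ‖shellVec X (n : ℤ)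
      (sInf {s : ℝ | 0 ≤ s ∧ s < T ∧ 1 / 2 ≤ fluxConst α * T * bigLam ε₀ ^ (n + 1) * ‖shellVec X (n : ℤ) s‖})‖ := by
  set S := {s : ℝ | 0 ≤ s ∧ s < T ∧ 1 / 2 ≤ fluxConst α * T * bigLam ε₀ ^ (n + 1) * ‖shellVec X (n : ℤ) s‖} with hS
  obtain ⟨t₀, ht₀⟩ := hne
  have hbdd : BddBelow S := ⟨0, fun s hs => hs.1⟩
  -- the truncated lit set `S' = S ∩ [0,t₀]` is closed, nonempty, with the same infimum
  set u : ℝ → ℝ := fun s => fluxConst α * T * bigLam ε₀ ^ (n + 1) * ‖shellVec X (n : ℤ) s‖ with hu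
  have hcx : ContinuousOn (fun s => shellVec X (n : ℤ) s) (Ico 0 T) := by
    have hcp : ContinuousOn (fun s => fun i => X i (n : ℤ) s) (Ico 0 T) :=
      continuousOn_pi.2 fun i s hs => ((hder i _ s hs).continuousWithinAt).mono fun x hx => hx.1
    exact (PiLp.continuous_toLp 2 (fun _ : Fin m => ℝ)).comp_continuousOn hcp
  have hcu : ContinuousOn u (Icc 0 t₀) :=
    continuousOn_const.mul (hcx.mono fun s hs => ⟨hs.1, lt_of_le_of_lt hs.2 ht₀.2.1⟩).norm
  set S' : Set ℝ := Icc 0 t₀ ∩ u ⁻¹' (Ici (1 / 2)) with hS'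
  have hS'closed : IsClosed S' := hcu.preimage_isClosed_of_isClosed isClosed_Icc isClosed_Ici
  have hS'sub : S' ⊆ S := fun s hs => ⟨hs.1.1, lt_of_le_of_lt hs.1.2 ht₀.2.1, hs.2⟩
  have ht₀' : t₀ ∈ S' := ⟨⟨ht₀.1, le_rfl⟩, ht₀.2.2⟩
  have hS'ne : S'.Nonempty := ⟨t₀, ht₀'⟩
  have hS'bdd : BddBelow S' := ⟨0, fun s hs => hs.1.1⟩
  have hmem : sInf S' ∈ S' := hS'closed.csInf_mem hS'ne hS'bdd
  have heq : sInf S = sInf S' := by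
    apply le_antisymm
    · exact csInf_le hbdd (hS'sub hmem)
    · refine le_csInf ⟨t₀, ht₀⟩ fun s hs => ?_
      rcases le_or_gt s t₀ with h | h
      · exact csInf_le hS'bdd ⟨⟨hs.1, h⟩, hs.2.2⟩
      · exact (csInf_le hS'bdd ht₀').trans h.le
  rw [heq]
  exact hmem.2

/-- **HOP TIME AGAINST THE HEAD PEAK.** If shell `n` is unlit on `[0,a)`, shell `n+1` is lit at `r`, and `u_n ≤ H` on
`[a, r]` only, then `a ≤ r` and `T/4 < (r - a) · H²`. [cite: Tao2016AveragedNS, §4 (4.3), Lemma 4.1 (4.8)–(4.10); §1.2] -/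
theorem hopTime_head {ε₀ T : ℝ} (hε : 0 < ε₀) (hT : 0 < T)
    {α : Fin m → Fin m → Fin m → ℤ × ℤ × ℤ → ℝ} (hc : IsCancellingCoeff α)
    {X : Fin m → ℤ → ℝ → ℝ} {X₀ : Fin m → ℝ}
    (hder : ∀ i k, ∀ t ∈ Ico 0 T, HasDerivWithinAt (X i k) (quadTerm ε₀ α X i k t) (Ici 0) t)
    (hinit : ∀ i k, X i k 0 = if k = 0 then X₀ i else 0)
    (hlow : ∀ i k t, k < 0 → X i k t = 0)
    (hreg : ∀ T' : ℝ, T' < T → ∃ M : ℝ, ∀ t ∈ Icc 0 T', ∀ (i : Fin m) (k : ℤ),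
      (1 + (1 + ε₀) ^ ((10 : ℝ) * k)) * |X i k t| ≤ M)
    (n : ℕ) {a r H : ℝ} (ha : a ∈ Ico 0 T) (hr : r ∈ Ico 0 T)
    (hunlit : ∀ s ∈ Ico 0 a, fluxConst α * T * bigLam ε₀ ^ (n + 1) * ‖shellVec X (n : ℤ) s‖ < 1 / 2)
    (hlit : 1 / 2 ≤ fluxConst α * T * bigLam ε₀ ^ (n + 1 + 1) * ‖shellVec X ((n + 1 : ℕ) : ℤ) r‖)
    (hH : ∀ s ∈ Icc a r, fluxConst α * T * bigLam ε₀ ^ (n + 1) * ‖shellVec X (n : ℤ) s‖ ≤ H) :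
    a ≤ r ∧ T / 4 < (r - a) * H ^ 2 := by
  have hCA : 0 ≤ fluxConst α := fluxConst_nonneg α
  have hL : 0 < bigLam ε₀ := bigLam_pos (by linarith)
  obtain ⟨r', hr', hlit'⟩ := orderedIgnition hε hT hc hder hinit hlow hreg n hr hlit
  have har : a ≤ r := by
    by_contra h
    push Not at h
    exact absurd (hunlit r' ⟨hr'.1, lt_of_le_of_lt hr'.2 h⟩) (not_lt.2 hlit')
  refine ⟨har, ?_⟩
  have h1 := normalised_succ_le_integral_sq hε hT hc hder hinit hlow hreg n r hr
  set u : ℝ → ℝ := fun s => fluxConst α * T * bigLam ε₀ ^ (n + 1) * ‖shellVec X (n : ℤ) s‖ with hu_def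
  have hcx : ContinuousOn (fun s => shellVec X (n : ℤ) s) (Ico 0 T) := by
    have hcp : ContinuousOn (fun s => fun i => X i (n : ℤ) s) (Ico 0 T) :=
      continuousOn_pi.2 fun i s hs => ((hder i _ s hs).continuousWithinAt).mono fun x hx => hx.1
    exact (PiLp.continuous_toLp 2 (fun _ : Fin m => ℝ)).comp_continuousOn hcp
  have hsub : Icc 0 r ⊆ Ico 0 T := fun s hs => ⟨hs.1, lt_of_le_of_lt hs.2 hr.2⟩
  have hcn : ContinuousOn u (Icc 0 r) := continuousOn_const.mul (hcx.mono hsub).norm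
  have hui : ∀ b c, b ∈ Icc 0 r → c ∈ Icc 0 r → IntervalIntegrable (fun s => u s ^ 2) volume b c := by
    intro b c hb hc'
    exact ((hcn.pow 2).mono (uIcc_subset_Icc hb hc')).intervalIntegrable
  have h0r : (0:ℝ) ∈ Icc 0 r := ⟨le_rfl, hr.1⟩
  have har' : a ∈ Icc 0 r := ⟨ha.1, har⟩
  have hrr : r ∈ Icc 0 r := ⟨hr.1, le_rfl⟩
  have hsplit : ∫ s in (0:ℝ)..r, u s ^ 2 = (∫ s in (0:ℝ)..a, u s ^ 2) + ∫ s in a..r, u s ^ 2 :=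
    (intervalIntegral.integral_add_adjacent_intervals (hui 0 a h0r har') (hui a r har' hrr)).symm
  have hpre : ∫ s in (0:ℝ)..a, u s ^ 2 ≤ a * (1 / 4 : ℝ) := by
    rcases eq_or_lt_of_le ha.1 with h0 | h0
    · rw [← h0, intervalIntegral.integral_same]; norm_num
    · have hle := le_half_on_Icc_of_unlit hder n ha h0 hunlit
      have hm : ∫ s in (0:ℝ)..a, u s ^ 2 ≤ ∫ _s in (0:ℝ)..a, (1 / 4 : ℝ) := by
        refine intervalIntegral.integral_mono_on ha.1 (hui 0 a h0r har') intervalIntegrable_const fun s hs => ?_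
        have h0u : 0 ≤ u s := by positivity
        nlinarith [hle s hs]
      rwa [intervalIntegral.integral_const, smul_eq_mul, sub_zero] at hm
  have hH0 : 0 ≤ H := le_trans (by positivity) (hH a ⟨le_rfl, har⟩)
  have hpost : ∫ s in a..r, u s ^ 2 ≤ (r - a) * H ^ 2 := by
    have hm : ∫ s in a..r, u s ^ 2 ≤ ∫ _s in a..r, H ^ 2 := by
      refine intervalIntegral.integral_mono_on har (hui a r har' hrr) intervalIntegrable_const fun s hs => ?_
      have h0u : 0 ≤ u s := by positivity
      exact pow_le_pow_left₀ h0u (hH s hs) 2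
    rwa [intervalIntegral.integral_const, smul_eq_mul] at hm
  have hsum : ∫ s in (0:ℝ)..r, u s ^ 2 ≤ a * (1 / 4) + (r - a) * H ^ 2 := by rw [hsplit]; linarith
  have hkey : (1 / 2 : ℝ) ≤ T⁻¹ * (a * (1 / 4) + (r - a) * H ^ 2) :=
    hlit.trans (h1.trans (mul_le_mul_of_nonneg_left hsum (inv_nonneg.2 hT.le)))
  have hkey' : T / 2 ≤ a * (1 / 4) + (r - a) * H ^ 2 := by
    have := mul_le_mul_of_nonneg_left hkey hT.le
    rwa [← mul_assoc, mul_inv_cancel₀ hT.ne', one_mul, mul_one_div] at this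
  linarith [ha.2]

/-- **THE FIRST-LIT CHAIN WITH HEAD PEAKS: `Σ_{n<N} H_n⁻² < 4` and fewer than `4L²` dim heads.** Along an exact blow-up flow
from a one-shell datum there are first-lit times `s_n ∈ [0,T)` (unlit before, lit AT `s_n`, increasing) such that for ANY
bounds `H_n ≥ u_n` on the head windows `[s_n, s_{n+1}]`: `s_n + T/(4H_n²) ≤ s_{n+1}`, `Σ_{n<N} H_n⁻² < 4` for every `N`, and for
every `L > 0` fewer than `4L²` of the shells `n < N` have `H_n ≤ L`.
[cite: Tao2016AveragedNS, §4 (4.3), Lemma 4.1 (4.5), (4.8)–(4.10), Thm. 4.2 (statement shape); §1.2] -/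
theorem exists_firstLitTimes_head {ε₀ T : ℝ} (hε : 0 < ε₀) (hT : 0 < T)
    {α : Fin m → Fin m → Fin m → ℤ × ℤ × ℤ → ℝ} (hc : IsCancellingCoeff α)
    {X : Fin m → ℤ → ℝ → ℝ} {X₀ : Fin m → ℝ}
    (hder : ∀ i k, ∀ t ∈ Ico 0 T, HasDerivWithinAt (X i k) (quadTerm ε₀ α X i k t) (Ici 0) t)
    (hinit : ∀ i k, X i k 0 = if k = 0 then X₀ i else 0)
    (hlow : ∀ i k t, k < 0 → X i k t = 0)
    (hreg : ∀ T' : ℝ, T' < T → ∃ M : ℝ, ∀ t ∈ Icc 0 T', ∀ (i : Fin m) (k : ℤ),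
      (1 + (1 + ε₀) ^ ((10 : ℝ) * k)) * |X i k t| ≤ M)
    (hcrit : ∀ L : ℝ, ∃ t : ℝ, 0 ≤ t ∧ t < T ∧
      ∃ (i : Fin m) (k : ℤ), L < (1 + ε₀) ^ ((5 : ℝ) * k / 2) * |X i k t|) :
    ∃ σ : ℕ → ℝ, (∀ n, 0 ≤ σ n ∧ σ n < T) ∧ (∀ n, σ n ≤ σ (n + 1)) ∧
      (∀ n : ℕ, ∀ s ∈ Ico 0 (σ n), fluxConst α * T * bigLam ε₀ ^ (n + 1) * ‖shellVec X (n : ℤ) s‖ < 1 / 2) ∧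
      (∀ n : ℕ, 1 / 2 ≤ fluxConst α * T * bigLam ε₀ ^ (n + 1) * ‖shellVec X (n : ℤ) (σ n)‖) ∧
      (∀ H : ℕ → ℝ, (∀ n : ℕ, ∀ s ∈ Icc (σ n) (σ (n + 1)),
          fluxConst α * T * bigLam ε₀ ^ (n + 1) * ‖shellVec X (n : ℤ) s‖ ≤ H n) →
        (∀ n, σ n + T / 4 * (H n ^ 2)⁻¹ ≤ σ (n + 1)) ∧
        (∀ N : ℕ, ∑ n ∈ Finset.range N, (H n ^ 2)⁻¹ < 4) ∧
        (∀ L : ℝ, 0 < L → ∀ N : ℕ, ((((Finset.range N).filter fun n => H n ≤ L).card : ℕ) : ℝ) < 4 * L ^ 2)) := by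
  have hfire := everyShellFires hε hT hc hder hinit hlow hreg hcrit
  let S : ℕ → Set ℝ := fun n =>
    {s | 0 ≤ s ∧ s < T ∧ 1 / 2 ≤ fluxConst α * T * bigLam ε₀ ^ (n + 1) * ‖shellVec X (n : ℤ) s‖}
  have hSne : ∀ n, (S n).Nonempty := fun n => by
    obtain ⟨t, ht0, htT, hlt⟩ := hfire n
    exact ⟨t, ht0, htT, by linarith⟩
  have hSbdd : ∀ n, BddBelow (S n) := fun n => ⟨0, fun s hs => hs.1⟩
  have hσ0 : ∀ n, 0 ≤ sInf (S n) := fun n => le_csInf (hSne n) fun s hs => hs.1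
  have hσT : ∀ n, sInf (S n) < T := fun n => by
    obtain ⟨t, ht⟩ := hSne n
    exact lt_of_le_of_lt (csInf_le (hSbdd n) ht) ht.2.1
  have hunlit : ∀ n, ∀ s ∈ Ico 0 (sInf (S n)),
      fluxConst α * T * bigLam ε₀ ^ (n + 1) * ‖shellVec X (n : ℤ) s‖ < 1 / 2 := fun n s hs => by
    by_contra h
    push Not at h
    exact notMem_of_lt_csInf hs.2 (hSbdd n) ⟨hs.1, lt_trans hs.2 (hσT n), h⟩
  have hmem : ∀ n : ℕ, 1 / 2 ≤ fluxConst α * T * bigLam ε₀ ^ (n + 1) * ‖shellVec X (n : ℤ) (sInf (S n))‖ :=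
    fun n => firstLit_mem hder n (hSne n)
  -- monotonicity from ordered ignition: shell `n+1` lit at `σ(n+1)` ⇒ shell `n` lit at some `r' ≤ σ(n+1)`
  have hmono : ∀ n, sInf (S n) ≤ sInf (S (n + 1)) := fun n => by
    obtain ⟨r', hr', hlit'⟩ := orderedIgnition hε hT hc hder hinit hlow hreg n ⟨hσ0 (n + 1), hσT (n + 1)⟩ (hmem (n + 1))
    exact (csInf_le (hSbdd n) ⟨hr'.1, lt_of_le_of_lt hr'.2 (hσT (n + 1)), hlit'⟩).trans hr'.2
  refine ⟨fun n => sInf (S n), fun n => ⟨hσ0 n, hσT n⟩, hmono, hunlit, hmem, fun H hH => ?_⟩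
  have hHpos : ∀ n, 0 < H n := fun n =>
    lt_of_lt_of_le (by norm_num) ((hmem n).trans (hH n (sInf (S n)) ⟨le_rfl, hmono n⟩))
  have hhop : ∀ n, sInf (S n) + T / 4 * (H n ^ 2)⁻¹ ≤ sInf (S (n + 1)) := fun n => by
    have h := hopTime_head hε hT hc hder hinit hlow hreg n (a := sInf (S n)) (r := sInf (S (n + 1))) (H := H n)
      ⟨hσ0 n, hσT n⟩ ⟨hσ0 (n + 1), hσT (n + 1)⟩ (hunlit n) (hmem (n + 1)) (hH n)
    have hH2 : 0 < H n ^ 2 := pow_pos (hHpos n) 2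
    have : T / 4 * (H n ^ 2)⁻¹ < sInf (S (n + 1)) - sInf (S n) := by
      rw [← div_eq_mul_inv, div_lt_iff₀ hH2]; exact h.2
    linarith
  have hsum : ∀ N : ℕ, ∑ n ∈ Finset.range N, (H n ^ 2)⁻¹ < 4 := by
    intro N
    have htel : ∀ M : ℕ, sInf (S 0) + ∑ n ∈ Finset.range M, T / 4 * (H n ^ 2)⁻¹ ≤ sInf (S M) := by
      intro M
      induction M with
      | zero => simp
      | succ M ih => rw [Finset.sum_range_succ]; linarith [hhop M]
    have hlt : ∑ n ∈ Finset.range N, T / 4 * (H n ^ 2)⁻¹ < T := by linarith [htel N, hσ0 0, hσT N]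
    rw [← Finset.mul_sum] at hlt
    by_contra hge
    push Not at hge
    have : T ≤ T / 4 * ∑ n ∈ Finset.range N, (H n ^ 2)⁻¹ := by nlinarith
    linarith
  refine ⟨hhop, hsum, fun L hL N => ?_⟩
  set F := (Finset.range N).filter fun n => H n ≤ L with hF
  have h1 : ∑ n ∈ F, (H n ^ 2)⁻¹ ≤ ∑ n ∈ Finset.range N, (H n ^ 2)⁻¹ :=
    Finset.sum_le_sum_of_subset_of_nonneg (Finset.filter_subset _ _) fun n _ _ =>
      inv_nonneg.2 (pow_nonneg (hHpos n).le 2)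
  have h2 : ∑ n ∈ F, (L ^ 2)⁻¹ ≤ ∑ n ∈ F, (H n ^ 2)⁻¹ := by
    refine Finset.sum_le_sum fun n hn => ?_
    have hnL : H n ≤ L := (Finset.mem_filter.1 hn).2
    exact inv_anti₀ (pow_pos (hHpos n) 2) (pow_le_pow_left₀ (hHpos n).le hnL 2)
  rw [Finset.sum_const, nsmul_eq_mul] at h2
  have hL2 : 0 < L ^ 2 := by positivity
  have h3 : (F.card : ℝ) * (L ^ 2)⁻¹ < 4 := lt_of_le_of_lt (h2.trans h1) (hsum N)
  rwa [← div_eq_mul_inv, div_lt_iff₀ hL2] at h3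

/-! ### Along a robust blow-up -/

/-- **THE HEAD OF THE FRONT IS BRIGHT ALONG A ROBUST BLOW-UP.** If `NoGlobalCascade ε₀ α X₀` (`ε₀ > 0`, `α ∈ E₂(R)`, any
`m`), the maximal exact cascade flow from the one-shell datum on `[0,T⋆)` carries first-lit times `s_0 ≤ s_1 ≤ ⋯ < T⋆`
(`u_n < 1/2` before `s_n`, `u_n(s_n) ≥ 1/2`) such that for any head-peak bounds `H_n ≥ u_n` on `[s_n, s_{n+1}]`:
`s_n + T⋆/(4H_n²) ≤ s_{n+1}`, `Σ_{n<N} H_n⁻² < 4`, and fewer than `4L²` shells `n < N` have `H_n ≤ L`.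
[cite: Tao2016AveragedNS, §4 Thm. 4.2 (statement shape), (4.3), Lemma 4.1 (4.5), (4.8)–(4.10), (4.12); §1.2] -/
theorem headPeaks_of_noGlobalCascade {ε₀ R : ℝ} (hε : 0 < ε₀)
    {α : Fin m → Fin m → Fin m → ℤ × ℤ × ℤ → ℝ} {X₀ : Fin m → ℝ} (hα : InTableClass R α)
    (hNG : NoGlobalCascade ε₀ α X₀) :
    ∃ (T : ℝ) (X : Fin m → ℤ → ℝ → ℝ) (σ : ℕ → ℝ), 0 < T ∧
      (∀ i n, ContDiffOn ℝ 1 (X i n) (Set.Ico 0 T)) ∧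
      (∀ i n, X i n 0 = if n = 0 then X₀ i else 0) ∧
      (∀ i n t, n < 0 → X i n t = 0) ∧
      (∀ i n t, 0 ≤ t → t < T → derivWithin (X i n) (Set.Ici 0) t = quadTerm ε₀ α X i n t) ∧
      (∀ n, 0 ≤ σ n ∧ σ n < T) ∧ (∀ n, σ n ≤ σ (n + 1)) ∧
      (∀ n : ℕ, ∀ s ∈ Ico 0 (σ n), fluxConst α * T * bigLam ε₀ ^ (n + 1) * ‖shellVec X (n : ℤ) s‖ < 1 / 2) ∧
      (∀ n : ℕ, 1 / 2 ≤ fluxConst α * T * bigLam ε₀ ^ (n + 1) * ‖shellVec X (n : ℤ) (σ n)‖) ∧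
      (∀ H : ℕ → ℝ, (∀ n : ℕ, ∀ s ∈ Icc (σ n) (σ (n + 1)),
          fluxConst α * T * bigLam ε₀ ^ (n + 1) * ‖shellVec X (n : ℤ) s‖ ≤ H n) →
        (∀ n, σ n + T / 4 * (H n ^ 2)⁻¹ ≤ σ (n + 1)) ∧
        (∀ N : ℕ, ∑ n ∈ Finset.range N, (H n ^ 2)⁻¹ < 4) ∧
        (∀ L : ℝ, 0 < L → ∀ N : ℕ, ((((Finset.range N).filter fun n => H n ≤ L).card : ℕ) : ℝ) < 4 * L ^ 2)) := by
  obtain ⟨T, X, hT, h1, h2, h3, h4, h5, h6⟩ := criticalBlowup_of_noGlobalCascade hε hα hNG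
  have hder : ∀ i k, ∀ τ ∈ Ico (0 : ℝ) T,
      HasDerivWithinAt (X i k) (quadTerm ε₀ α X i k τ) (Ici 0) τ := by
    intro i k τ hτ
    have hd : DifferentiableWithinAt ℝ (X i k) (Ico 0 T) τ :=
      ((h1 i k).differentiableOn one_ne_zero) τ hτ
    have hd' : DifferentiableWithinAt ℝ (X i k) (Ici 0) τ :=
      hd.mono_of_mem_nhdsWithin (by
        rw [mem_nhdsWithin]
        exact ⟨Iio T, isOpen_Iio, hτ.2, fun x hx => ⟨hx.2, hx.1⟩⟩)
    rw [← h4 i k τ hτ.1 hτ.2]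
    exact hd'.hasDerivWithinAt
  have hreg : ∀ T' : ℝ, T' < T → ∃ M : ℝ, ∀ τ ∈ Icc (0 : ℝ) T', ∀ (i : Fin m) (k : ℤ),
      (1 + (1 + ε₀) ^ ((10 : ℝ) * k)) * |X i k τ| ≤ M := by
    intro T' hT'
    rcases le_or_gt T' 0 with h0 | h0
    · obtain ⟨M, hM⟩ := h5 (T / 2) (by linarith) (by linarith)
      exact ⟨M, fun τ hτ i k => hM τ hτ.1 (by linarith [hτ.2]) i k⟩
    · obtain ⟨M, hM⟩ := h5 T' h0 hT'
      exact ⟨M, fun τ hτ i k => hM τ hτ.1 hτ.2 i k⟩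
  obtain ⟨σ, hσ, hmono, hun, hmem, hH⟩ := exists_firstLitTimes_head hε hT hα.2.1 hder h2 h3 hreg h6
  exact ⟨T, X, σ, hT, h1, h2, h3, h4, hσ, hmono, hun, hmem, hH⟩


/-! ### High shells light late -/

/-- **High shells are unlit early, at any threshold.** Under (4.5)-regularity before `T`: for every `T' < T` and `η > 0` there is
`K` with `u_k(t) = C_A T Λ^{k+1}‖x_k(t)‖ < η` for all `k ≥ K`, `t ∈ [0,T']` (the (4.5) weight `Λ^{4k}` beats `Λ^{k+1}`).
[cite: Tao2016AveragedNS, §4 Lemma 4.1 (4.5) and (4.1)] -/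
theorem unlit_early {ε₀ T : ℝ} (hε : 0 < ε₀) (hT : 0 < T)
    {α : Fin m → Fin m → Fin m → ℤ × ℤ × ℤ → ℝ} {X : Fin m → ℤ → ℝ → ℝ}
    (hreg : ∀ T' : ℝ, T' < T → ∃ M : ℝ, ∀ t ∈ Icc 0 T', ∀ (i : Fin m) (k : ℤ),
      (1 + (1 + ε₀) ^ ((10 : ℝ) * k)) * |X i k t| ≤ M)
    {T' η : ℝ} (hT' : T' < T) (hη : 0 < η) :
    ∃ K : ℕ, ∀ k : ℕ, K ≤ k → ∀ t ∈ Icc 0 T',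
      fluxConst α * T * bigLam ε₀ ^ (k + 1) * ‖shellVec X (k : ℤ) t‖ < η := by
  have hb : (0 : ℝ) < 1 + ε₀ := by linarith
  have hL : 0 < bigLam ε₀ := bigLam_pos (by linarith)
  have hL1 : 1 < bigLam ε₀ := Real.one_lt_rpow (by linarith) (by norm_num)
  have hCA : 0 ≤ fluxConst α := fluxConst_nonneg α
  obtain ⟨M, hM⟩ := hreg T' hT'
  have hcomp : ∀ (k : ℕ), ∀ t ∈ Icc (0:ℝ) T', ∀ i : Fin m, (bigLam ε₀ ^ k) ^ 4 * |X i (k : ℤ) t| ≤ M := by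
    intro k t ht i
    have h := hM t ht i (k : ℤ)
    have hw : (bigLam ε₀ ^ k) ^ 4 ≤ 1 + (1 + ε₀) ^ ((10 : ℝ) * ((k : ℤ) : ℝ)) := by
      have h4 : (bigLam ε₀ ^ k) ^ 4 = (1 + ε₀) ^ (10 * k) := by
        rw [show ((bigLam ε₀ ^ k) ^ 4) = ((bigLam ε₀ ^ k) ^ 2) ^ 2 by ring, bigLam_pow_sq hε.le k, ← pow_mul]
        ring_nf
      have h10 : (1 + ε₀) ^ ((10 : ℝ) * ((k : ℤ) : ℝ)) = (1 + ε₀) ^ (10 * k) := by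
        rw [show (10 : ℝ) * ((k : ℤ) : ℝ) = ((10 * k : ℕ) : ℝ) by push_cast; ring, Real.rpow_natCast]
      rw [h4, h10]
      linarith [pow_nonneg hb.le (10 * k)]
    calc (bigLam ε₀ ^ k) ^ 4 * |X i (k : ℤ) t| ≤ (1 + (1 + ε₀) ^ ((10 : ℝ) * ((k : ℤ) : ℝ))) * |X i (k : ℤ) t| :=
          mul_le_mul_of_nonneg_right hw (abs_nonneg _)
      _ ≤ M := h
  set A : ℝ := fluxConst α * T * bigLam ε₀ * Real.sqrt m * |M| + 1 with hA
  have hA0 : 0 < A := by positivity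
  have hy1 : ((bigLam ε₀) ^ 3)⁻¹ < 1 := inv_lt_one_of_one_lt₀ (one_lt_pow₀ hL1 (by norm_num))
  have hy0 : 0 ≤ ((bigLam ε₀) ^ 3)⁻¹ := by positivity
  obtain ⟨K, hK⟩ := exists_pow_lt_of_lt_one (div_pos hη hA0) hy1
  refine ⟨K, fun k hk t ht => ?_⟩
  have hMk : ∀ i : Fin m, |X i (k : ℤ) t| ≤ |M| * ((bigLam ε₀ ^ k) ^ 4)⁻¹ := by
    intro i
    have h := hcomp k t ht i
    have hpos : 0 < (bigLam ε₀ ^ k) ^ 4 := by positivity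
    rw [← div_eq_mul_inv, le_div_iff₀ hpos, mul_comm]
    exact h.trans (le_abs_self M)
  have hnorm := norm_shellVec_le_sqrt_mul (by positivity) hMk
  have hyk : (((bigLam ε₀) ^ 3)⁻¹) ^ k ≤ (((bigLam ε₀) ^ 3)⁻¹) ^ K := pow_le_pow_of_le_one hy0 hy1.le hk
  have hq3 : (((bigLam ε₀) ^ 3)⁻¹) ^ k = ((bigLam ε₀ ^ k) ^ 3)⁻¹ := by
    rw [inv_pow, ← pow_mul, mul_comm, pow_mul]
  calc fluxConst α * T * bigLam ε₀ ^ (k + 1) * ‖shellVec X (k : ℤ) t‖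
      ≤ fluxConst α * T * bigLam ε₀ ^ (k + 1) * (Real.sqrt m * (|M| * ((bigLam ε₀ ^ k) ^ 4)⁻¹)) :=
        mul_le_mul_of_nonneg_left hnorm (by positivity)
    _ = (fluxConst α * T * bigLam ε₀ * Real.sqrt m * |M|) * (((bigLam ε₀) ^ 3)⁻¹) ^ k := by
        rw [hq3, pow_succ]
        field_simp
    _ ≤ A * (((bigLam ε₀) ^ 3)⁻¹) ^ K := by
        refine mul_le_mul (by rw [hA]; linarith) hyk (pow_nonneg hy0 k) hA0.le
    _ < A * (η / A) := mul_lt_mul_of_pos_left hK hA0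
    _ = η := mul_div_cancel₀ η hA0.ne'

/-- **HIGH SHELLS LIGHT LATE**: for every `T' < T` there is `K` such that no shell `k ≥ K` is lit (`u_k ≥ 1/2`) at any time
`≤ T'`; in particular the first-lit times of `exists_firstLitTimes_head` tend to `T` (`σ_n → ∞` in log-time).
[cite: Tao2016AveragedNS, §4 Lemma 4.1 (4.5)] -/
theorem lit_late {ε₀ T : ℝ} (hε : 0 < ε₀) (hT : 0 < T)
    {α : Fin m → Fin m → Fin m → ℤ × ℤ × ℤ → ℝ} {X : Fin m → ℤ → ℝ → ℝ}
    (hreg : ∀ T' : ℝ, T' < T → ∃ M : ℝ, ∀ t ∈ Icc 0 T', ∀ (i : Fin m) (k : ℤ),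
      (1 + (1 + ε₀) ^ ((10 : ℝ) * k)) * |X i k t| ≤ M)
    {T' : ℝ} (hT' : T' < T) :
    ∃ K : ℕ, ∀ k : ℕ, K ≤ k → ∀ r : ℝ, 0 ≤ r →
      1 / 2 ≤ fluxConst α * T * bigLam ε₀ ^ (k + 1) * ‖shellVec X (k : ℤ) r‖ → T' < r := by
  obtain ⟨K, hK⟩ := unlit_early (α := α) (X := X) hε hT hreg hT' (by norm_num : (0:ℝ) < 1 / 2)
  refine ⟨K, fun k hk r hr0 hlit => ?_⟩
  by_contra hle
  push Not at hle
  exact absurd (hK k hk r ⟨hr0, hle⟩) (not_lt.2 hlit)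

end BlowupRigidityOne

end Summit.NavierStokesRegularity.NavierStokesRegularity.Theorems

end
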